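import Literature.NumberTheory.Automorphic.ContractingTransversalDistanceRegular   -- ★ p832624 (A-p03 (g22), L2-gen): `not_isSquareIntegrableModCenter_of_isSpherical_of_contracting`
import HarnessLib

/-!
# Road (B), transport leg: the contracting-transversal criterion pulled back along an isomorphism of topological groups

Topic `NumberTheory/Automorphic`; namespace `Literature.NumberTheory.Automorphic.SphericalCoefficient` (the home of ★ L4γ
`DistanceRegularHeckeShellCount` and ★ (L2-gen) `ContractingTransversalDistanceRegular`).  THEOREMS ONLY: no definition, no named fact, no
instance, no notation, no `sorry`.  Cell `hodgecm-mathlib`, floor 0, programme P3, road (B) for the letters #90 (SqNS)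
`Rogawski1990.SquareIntegrableNotSphericalCofinite` ⇒ #79 (XP) `Rogawski1990.XiPinSphericalCofinite`; leg (L5) «CM transport», generic half
(seat B-p08 (g23); F0P3-plan (g7) «=» 2026-08-31T19:48:39Z on A-p03 (g22)'s sequence (L2-gen) → (L1) → (L1b) → (L5)).

## The mathematics

★ (L2-gen) `not_isSquareIntegrableModCenter_of_isSpherical_of_contracting` says: if a locally compact group `G` carries a compact open subgroup
`K ⊇ Z(G)`, a subgroup `K_N ≤ K`, an element `t` contracting `K_N`, symmetric (`t⁻¹ ∈ KtK`) with pairwise disjoint shells `K tⁿ K`, and a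
transversal `X₊ ∪ X₀ ∪ {t⁻¹}` of `KtK/K` of type `(ab, b − 1, 1)` with `b ≤ a`, `ab ≥ 2`, then no smooth `K`-spherical representation of `G` is
square-integrable modulo the centre.  Road (B) VERIFIES these hypotheses in a MODEL group — the one-place model `U(σ_w, Φ₃)(L_w)` of
`U(Φ₃)(L⁺_v)` at an inert unramified place, with its hyperspecial `K₀ = U ∩ GL₃(𝒪_w)` (A-p03 (g22)'s (L1) ∕ (L1b)) — while the letters #90 ∕ #79 speak
of representations of `Gqs L v = U(Φ₃)(L⁺_v)` and of the level `cmLocalIntegralLevel L 3 Φ₃ v`.  The criterion is about GROUP-THEORETIC DATA,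
so the cheapest junction is to pull the data back along the isomorphism of topological groups `e : G ≃ₜ* G′` (★ `localNonsplitEquiv`), rather
than to push representations, smooth duals and Haar measures on `G ⧸ Z(G)` forward:

* §1 `bijOn_coe_orbit_iff` — the transversal condition `Set.BijOn (· : G → G ⧸ K) X (K · tK)` in ELEMENTWISE form: `X ⊆ KtK`, `x⁻¹y ∈ K ⇒ x = y`
  on `X`, and every `g ∈ KtK` has `x ∈ X` with `x⁻¹ g ∈ K` (★ `mk_mem_orbit_iff`, `QuotientGroup.eq`);
* §2 the pull-backs: `K := e⁻¹(K′)` is compact open and contains `Z(G)`; `K_N := e⁻¹(K_N′)`; `t := e⁻¹(t′)` contracts, is symmetric, has disjoint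
  shells; `X₊ := e⁻¹(X₊′)`, `X₀ := e⁻¹(X₀′)` keep their cardinalities and memberships, and the transversal condition transports clause by clause;
* §3 **`not_isSquareIntegrableModCenter_of_isSpherical_of_contracting_comap`**: the criterion for `G` with ALL data given in `G′` and the level
  `K′.comap e` — so that the CM instance only has to identify `cmLocalIntegralLevel` with `e⁻¹(K₀)` (★ `mem_localIntegralLevel_iff_of_smul_eq`).

Print: [Macdonald1971, Ch. V §3] (spherical functions on `p`-adic groups via the building; no square-integrable spherical class for
hyperspecial `K`); [BruhatTits1972, (4.4.4)]; [SerreTrees1980, II.1.1] (the tree of a rank-one group); [HarishChandra1970, Part I §1 p. 4]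
(square-integrability modulo the centre).  Functoriality along isomorphisms of topological groups is folklore.
HONEST LABEL: HC_CM is proved only modulo the printed citations (2 named inputs hLiu418, h413 remain, and behind them the booked printed
statements) until rung 0 closes; this file is hypothesis-free group theory and discharges no letter by itself.
-/

set_option autoImplicit false

noncomputable section

open MeasureTheory MulAction
open scoped Pointwise

namespace Literature.NumberTheory.Automorphic.SphericalCoefficient

/-! ## §1 The transversal condition in elementwise form -/

section Elementwise

variable {G : Type*} [Group G] (K : Subgroup G) (t : G) (X : Set G)

/-- **`X` is a transversal of `KtK/K` iff** (i) `X ⊆ KtK`, (ii) distinct elements of `X` lie in distinct left `K`-cosets (`x⁻¹ y ∈ K ⇒ x = y`),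
(iii) every `g ∈ KtK` is `K`-equivalent to some `x ∈ X` (`x⁻¹ g ∈ K`). [cite: SerreTrees1980, II.1.1] [cite: BruhatTits1972, (4.4.4)] -/
theorem bijOn_coe_orbit_iff :
    Set.BijOn (fun x : G => (x : G ⧸ K)) X (orbit K (t : G ⧸ K)) ↔
      (∀ x ∈ X, x ∈ DoubleCoset.doubleCoset t (K : Set G) K) ∧
      (∀ x ∈ X, ∀ y ∈ X, x⁻¹ * y ∈ K → x = y) ∧
      (∀ g ∈ DoubleCoset.doubleCoset t (K : Set G) K, ∃ x ∈ X, x⁻¹ * g ∈ K) := by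
  constructor
  · rintro ⟨hmaps, hinj, hsurj⟩
    refine ⟨fun x hx => (mk_mem_orbit_iff (K := K) x).1 (hmaps hx), fun x hx y hy hxy => hinj hx hy (QuotientGroup.eq.2 hxy),
      fun g hg => ?_⟩
    obtain ⟨x, hx, hxg⟩ := hsurj ((mk_mem_orbit_iff (K := K) g).2 hg)
    exact ⟨x, hx, QuotientGroup.eq.1 hxg⟩
  · rintro ⟨hmem, hinj, hsurj⟩
    refine ⟨fun x hx => (mk_mem_orbit_iff (K := K) x).2 (hmem x hx), fun x hx y hy hxy => hinj x hx y hy (QuotientGroup.eq.1 hxy),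
      fun q hq => ?_⟩
    obtain ⟨g, rfl⟩ := QuotientGroup.mk_surjective q
    obtain ⟨x, hx, hxg⟩ := hsurj g ((mk_mem_orbit_iff (K := K) g).1 hq)
    exact ⟨x, hx, QuotientGroup.eq.2 hxg⟩

end Elementwise

/-! ## §2 Pull-backs of the data along an isomorphism of (topological) groups -/

section Pullback

variable {G G' : Type*} [Group G] [Group G'] (e : G ≃* G') {K' KN' : Subgroup G'} {t' : G'}

/-- `e` maps the centre of `G` into the centre of `G′`. [cite: BruhatTits1972, (4.4.4)] -/
theorem map_mem_center {z : G} (hz : z ∈ Subgroup.center G) : e z ∈ Subgroup.center G' := by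
  rw [Subgroup.mem_center_iff] at hz ⊢
  intro g'
  obtain ⟨g, rfl⟩ := e.surjective g'
  rw [← map_mul, ← map_mul, hz g]

/-- `Z(G) ≤ e⁻¹(K′)` when `Z(G′) ≤ K′`. [cite: BruhatTits1972, (4.4.4)] -/
theorem center_le_comap (hZK' : Subgroup.center G' ≤ K') : Subgroup.center G ≤ K'.comap (e : G →* G') :=
  fun _ hz => hZK' (map_mem_center e hz)

/-- Contraction transports: `t K_N t⁻¹ ≤ K_N` for `t = e⁻¹ t′`, `K_N = e⁻¹ K_N′`. [cite: BruhatTits1972, (4.4.4)] -/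
theorem conj_mem_comap_of_conj_mem (ht' : ∀ u ∈ KN', t' * u * t'⁻¹ ∈ KN') {u : G} (hu : u ∈ KN'.comap (e : G →* G')) :
    e.symm t' * u * (e.symm t')⁻¹ ∈ KN'.comap (e : G →* G') := by
  rw [Subgroup.mem_comap] at hu ⊢
  simpa [map_mul, map_inv] using ht' _ hu

/-- Membership in a double coset transports along `e`: `g ∈ K s K ↔ e g ∈ K′ (e s) K′` for `K = e⁻¹ K′`. [cite: BruhatTits1972, (4.4.4)] -/
theorem mem_doubleCoset_comap_iff (s g : G) :
    g ∈ DoubleCoset.doubleCoset s (K'.comap (e : G →* G') : Set G) (K'.comap (e : G →* G')) ↔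
      e g ∈ DoubleCoset.doubleCoset (e s) (K' : Set G') K' := by
  rw [DoubleCoset.mem_doubleCoset, DoubleCoset.mem_doubleCoset]
  constructor
  · rintro ⟨x, hx, y, hy, rfl⟩
    exact ⟨e x, hx, e y, hy, by rw [map_mul, map_mul]⟩
  · rintro ⟨x', hx', y', hy', h⟩
    refine ⟨e.symm x', ?_, e.symm y', ?_, ?_⟩
    · rw [SetLike.mem_coe, Subgroup.mem_comap, MonoidHom.coe_coe, MulEquiv.apply_symm_apply]; exact hx'
    · rw [SetLike.mem_coe, Subgroup.mem_comap, MonoidHom.coe_coe, MulEquiv.apply_symm_apply]; exact hy'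
    · apply e.injective
      rw [h, map_mul, map_mul, MulEquiv.apply_symm_apply, MulEquiv.apply_symm_apply]

/-- Symmetry transports: `t⁻¹ ∈ KtK` for `t = e⁻¹ t′`. [cite: SerreTrees1980, II.1.1] -/
theorem symm_inv_mem_doubleCoset (hsymm' : t'⁻¹ ∈ DoubleCoset.doubleCoset t' (K' : Set G') K') :
    (e.symm t')⁻¹ ∈ DoubleCoset.doubleCoset (e.symm t') (K'.comap (e : G →* G') : Set G) (K'.comap (e : G →* G')) := by
  rw [mem_doubleCoset_comap_iff, map_inv, MulEquiv.apply_symm_apply]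
  exact hsymm'

/-- Disjointness of the shells transports: `K tᵐ K ∩ K tⁿ K = ∅` (`m ≠ n`) for `t = e⁻¹ t′`. [cite: BruhatTits1972, (4.4.4)] [cite: Tits1979, §3.3.3] -/
theorem disjoint_doubleCoset_pow_comap
    (hD' : ∀ m n : ℕ, m ≠ n → Disjoint (DoubleCoset.doubleCoset (t' ^ m) (K' : Set G') K') (DoubleCoset.doubleCoset (t' ^ n) (K' : Set G') K'))
    (m n : ℕ) (hmn : m ≠ n) :
    Disjoint (DoubleCoset.doubleCoset (e.symm t' ^ m) (K'.comap (e : G →* G') : Set G) (K'.comap (e : G →* G')))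
      (DoubleCoset.doubleCoset (e.symm t' ^ n) (K'.comap (e : G →* G') : Set G) (K'.comap (e : G →* G'))) := by
  rw [Set.disjoint_left]
  intro g hm hn
  rw [mem_doubleCoset_comap_iff, map_pow, MulEquiv.apply_symm_apply] at hm hn
  exact Set.disjoint_left.1 (hD' m n hmn) hm hn

/-- The transversal condition transports: if `X′` is a transversal of `K′t′K′/K′` then `e⁻¹(X′)` is a transversal of `KtK/K`.
[cite: SerreTrees1980, II.1.1] [cite: BruhatTits1972, (4.4.4)] -/
theorem bijOn_coe_orbit_preimage {X' : Set G'} (hX' : Set.BijOn (fun x : G' => (x : G' ⧸ K')) X' (orbit K' (t' : G' ⧸ K'))) :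
    Set.BijOn (fun x : G => (x : G ⧸ K'.comap (e : G →* G'))) (e.symm '' X')
      (orbit (K'.comap (e : G →* G')) (e.symm t' : G ⧸ K'.comap (e : G →* G'))) := by
  obtain ⟨hmem, hinj, hsurj⟩ := (bijOn_coe_orbit_iff K' t' X').1 hX'
  refine (bijOn_coe_orbit_iff _ _ _).2 ⟨?_, ?_, ?_⟩
  · rintro x ⟨x', hx', rfl⟩
    rw [mem_doubleCoset_comap_iff, MulEquiv.apply_symm_apply, MulEquiv.apply_symm_apply]
    exact hmem x' hx'
  · rintro x ⟨x', hx', rfl⟩ y ⟨y', hy', rfl⟩ hxy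
    rw [Subgroup.mem_comap, MonoidHom.coe_coe, map_mul, map_inv, MulEquiv.apply_symm_apply, MulEquiv.apply_symm_apply] at hxy
    rw [hinj x' hx' y' hy' hxy]
  · intro g hg
    rw [mem_doubleCoset_comap_iff, MulEquiv.apply_symm_apply] at hg
    obtain ⟨x', hx', hx'g⟩ := hsurj (e g) hg
    refine ⟨e.symm x', Set.mem_image_of_mem _ hx', ?_⟩
    rw [Subgroup.mem_comap, MonoidHom.coe_coe, map_mul, map_inv, MulEquiv.apply_symm_apply]
    exact hx'g

end Pullback

/-! ## §3 The criterion with all data in the model group `G′` -/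

section Main

variable {G G' V : Type*} [Group G] [DecidableEq G] [TopologicalSpace G] [IsTopologicalGroup G]
  [Group G'] [DecidableEq G'] [TopologicalSpace G']
  [AddCommGroup V] [Module ℂ V] [MeasurableSpace (G ⧸ Subgroup.center G)] [BorelSpace (G ⧸ Subgroup.center G)]
  {ρ : Representation ℂ G V}

/-- **THE CONTRACTING-TRANSVERSAL CRITERION, PULLED BACK ALONG `e : G ≃ₜ* G′`.**  Let the data of ★
`not_isSquareIntegrableModCenter_of_isSpherical_of_contracting` be given in `G′`: `K′` compact open with `Z(G′) ≤ K′`, `K_N′ ≤ K′`, `t′` contracting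
`K_N′`, symmetric, with pairwise disjoint shells, and finite sets `X₊′` (`x t′⁻¹ ∈ K_N′`, `|X₊′| = ab`), `X₀′` (`t′ x t′⁻¹ ∈ K_N′`, `|X₀′| = b − 1`)
with `X₊′ ∪ X₀′ ∪ {t′⁻¹}` a transversal of `K′t′K′/K′`, `b ≤ a`, `ab ≥ 2`.  Then no SMOOTH representation `ρ` of `G` that is spherical for the
pulled-back level `e⁻¹(K′) = K′.comap e` is square-integrable modulo the centre of `G`, for any Haar measure on `G ⧸ Z(G)` — ★ (L2-gen) applied in
`G` to the pulled-back data of §2. [cite: Macdonald1971, Ch. V §3] [cite: BruhatTits1972, (4.4.4)] [cite: SerreTrees1980, II.1.1]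
[cite: HarishChandra1970, Part I §1 p. 4] -/
theorem not_isSquareIntegrableModCenter_of_isSpherical_of_contracting_comap (e : G ≃ₜ* G') {K' KN' : Subgroup G'}
    {a b : ℕ} (hba : b ≤ a) (hab : 2 ≤ a * b)
    (hKo' : IsOpen (K' : Set G')) (hKc' : IsCompact (K' : Set G')) (hZK' : Subgroup.center G' ≤ K') (hKN' : KN' ≤ K') {t' : G'}
    (ht' : ∀ u ∈ KN', t' * u * t'⁻¹ ∈ KN') (hsymm' : t'⁻¹ ∈ DoubleCoset.doubleCoset t' (K' : Set G') K')
    (hD' : ∀ m n : ℕ, m ≠ n → Disjoint (DoubleCoset.doubleCoset (t' ^ m) (K' : Set G') K') (DoubleCoset.doubleCoset (t' ^ n) (K' : Set G') K'))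
    {Xp' X0' : Finset G'} (hXp' : ∀ x ∈ Xp', x * t'⁻¹ ∈ KN') (hX0' : ∀ x ∈ X0', t' * x * t'⁻¹ ∈ KN')
    (hX' : Set.BijOn (fun x : G' => (x : G' ⧸ K')) (Xp' ∪ X0' ∪ {t'⁻¹} : Finset G') (orbit K' (t' : G' ⧸ K')))
    (hcardp' : Xp'.card = a * b) (hcard0' : X0'.card = b - 1)
    (hρ : ρ.IsSmooth) (h1 : ρ.IsSpherical (K'.comap (e : G →* G'))) (μ : Measure (G ⧸ Subgroup.center G)) [μ.IsHaarMeasure] :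
    ¬ ρ.IsSquareIntegrableModCenter μ := by
  -- the pulled-back data
  have hKo : IsOpen (K'.comap (e : G →* G') : Set G) := by
    rw [Subgroup.coe_comap, MonoidHom.coe_coe]
    exact hKo'.preimage e.continuous
  have hKc : IsCompact (K'.comap (e : G →* G') : Set G) := by
    rw [Subgroup.coe_comap, MonoidHom.coe_coe]
    exact e.toHomeomorph.isCompact_preimage.2 hKc'
  have hZK : Subgroup.center G ≤ K'.comap (e : G →* G') := center_le_comap e.toMulEquiv hZK'
  have hKN : KN'.comap (e : G →* G') ≤ K'.comap (e : G →* G') := Subgroup.comap_mono hKN'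
  have ht : ∀ u ∈ KN'.comap (e : G →* G'), e.symm t' * u * (e.symm t')⁻¹ ∈ KN'.comap (e : G →* G') :=
    fun u hu => conj_mem_comap_of_conj_mem e.toMulEquiv ht' hu
  have hsymm := symm_inv_mem_doubleCoset e.toMulEquiv (K' := K') hsymm'
  have hD := disjoint_doubleCoset_pow_comap e.toMulEquiv (K' := K') hD'
  have hXp : ∀ x ∈ Xp'.image e.symm, x * (e.symm t')⁻¹ ∈ KN'.comap (e : G →* G') := by
    intro x hx
    obtain ⟨x', hx', rfl⟩ := Finset.mem_image.1 hx
    rw [Subgroup.mem_comap, MonoidHom.coe_coe, map_mul, map_inv, ContinuousMulEquiv.apply_symm_apply,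
      ContinuousMulEquiv.apply_symm_apply]
    exact hXp' x' hx'
  have hX0 : ∀ x ∈ X0'.image e.symm, e.symm t' * x * (e.symm t')⁻¹ ∈ KN'.comap (e : G →* G') := by
    intro x hx
    obtain ⟨x', hx', rfl⟩ := Finset.mem_image.1 hx
    rw [Subgroup.mem_comap, MonoidHom.coe_coe, map_mul, map_mul, map_inv, ContinuousMulEquiv.apply_symm_apply,
      ContinuousMulEquiv.apply_symm_apply]
    exact hX0' x' hx'
  have hXset : ((Xp'.image e.symm ∪ X0'.image e.symm ∪ {(e.symm t')⁻¹} : Finset G) : Set G) =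
      e.toMulEquiv.symm '' ((Xp' ∪ X0' ∪ {t'⁻¹} : Finset G') : Set G') := by
    rw [Finset.coe_union, Finset.coe_union, Finset.coe_image, Finset.coe_image, Finset.coe_singleton, Finset.coe_union,
      Finset.coe_union, Finset.coe_singleton, Set.image_union, Set.image_union, Set.image_singleton, map_inv]
    rfl
  have hX : Set.BijOn (fun x : G => (x : G ⧸ K'.comap (e : G →* G')))
      (Xp'.image e.symm ∪ X0'.image e.symm ∪ {(e.symm t')⁻¹} : Finset G) (orbit (K'.comap (e : G →* G')) (e.symm t' : G ⧸ K'.comap (e : G →* G'))) := by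
    rw [hXset]
    exact bijOn_coe_orbit_preimage e.toMulEquiv hX'
  have hcardp : (Xp'.image e.symm).card = a * b := by rw [Finset.card_image_of_injective _ e.symm.injective, hcardp']
  have hcard0 : (X0'.image e.symm).card = b - 1 := by rw [Finset.card_image_of_injective _ e.symm.injective, hcard0']
  exact not_isSquareIntegrableModCenter_of_isSpherical_of_contracting hba hab hKo hKc hZK hKN ht hsymm hD hXp hX0 hX hcardp hcard0
    hρ h1 μ

end Main

end Literature.NumberTheory.Automorphic.SphericalCoefficient

end
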